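import Mathlib.GroupTheory.FiniteAbelian.Basic
import Mathlib.GroupTheory.Index
import Mathlib.Data.ZMod.QuotientGroup
import HarnessLib

/-!
# Subgroups of infinite index in finitely generated abelian groups lie in subgroups of index `2`

Two elementary facts about a finitely generated abelian group `G`, used in covering-space
arguments (an infinite-sheeted covering is dominated by a connected double covering):

* `exists_addMonoidHom_int_surjective_of_infinite`: an infinite finitely generated abelian group
  surjects onto `ℤ` (structure theorem, Mathlib `AddCommGroup.equiv_free_prod_directSum_zmod`: the
  free part `ℤⁿ` has `n ≥ 1`);
* `AddSubgroup.exists_le_index_eq_two_of_index_eq_zero`: a subgroup `H` of infinite index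
  (`H.index = 0`) of a finitely generated abelian group is contained in a subgroup of index `2`
  (the kernel of `G → G/H → ℤ → ℤ/2`); `Subgroup.exists_le_index_eq_two_of_index_eq_zero`: the
  same for a group `G` isomorphic to (the multiplicative version of) a finitely generated abelian
  group — the form used for fundamental groups of topological groups, which Mathlib only knows to be
  `Group`s with `IsMulCommutative`.

Everything is proved. (J. Rotman, *An Introduction to the Theory of Groups*, Thm. 10.20 ff. for
the structure theorem; the statements themselves are folklore.)
-/

namespace Literature.GroupTheory.Index

open Function

/-- **An infinite finitely generated abelian group surjects onto `ℤ`**: in the decomposition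
`G ≃ ℤⁿ × ⨁ ℤ/pᵢ^{eᵢ}` (Mathlib `AddCommGroup.equiv_free_prod_directSum_zmod`) the torsion part is
finite, so `n ≥ 1`, and a coordinate projection of `ℤⁿ` is onto. [folklore] -/
theorem exists_addMonoidHom_int_surjective_of_infinite {Q : Type*} [AddCommGroup Q] [AddGroup.FG Q]
    [Infinite Q] : ∃ π : Q →+ ℤ, Surjective π := by
  obtain ⟨n, ι, _, p, hp, e, ⟨f⟩⟩ := AddCommGroup.equiv_free_prod_directSum_zmod (G := Q)
  have hn : n ≠ 0 := by
    rintro rfl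
    haveI : ∀ i, NeZero (p i ^ e i) := fun i => ⟨pow_ne_zero _ (hp i).ne_zero⟩
    haveI : Finite (Fin 0 →₀ ℤ) := by
      haveI : Subsingleton (Fin 0 →₀ ℤ) := inferInstance
      infer_instance
    haveI : Finite (DirectSum ι fun i => ZMod (p i ^ e i)) :=
      Finite.of_equiv (Π i, ZMod (p i ^ e i)) (DirectSum.linearEquivFunOnFintype ℤ ι _).symm.toEquiv
    haveI : Finite ((Fin 0 →₀ ℤ) × DirectSum ι fun i => ZMod (p i ^ e i)) := inferInstance
    exact @not_finite Q _ (Finite.of_equiv _ f.toEquiv.symm)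
  let k : Fin n := ⟨0, Nat.pos_of_ne_zero hn⟩
  refine ⟨(Finsupp.applyAddHom k).comp ((AddMonoidHom.fst _ _).comp f.toAddMonoidHom), fun z => ?_⟩
  refine ⟨f.symm (Finsupp.single k z, 0), ?_⟩
  simp [k]

/-- **A subgroup of infinite index of a finitely generated abelian group lies in a subgroup of
index `2`**: `G/H` is an infinite finitely generated abelian group, so it maps onto `ℤ`, hence onto
`ℤ/2`; the kernel of `G → G/H → ℤ → ℤ/2` contains `H` and has index `2`. [folklore] -/
theorem AddSubgroup.exists_le_index_eq_two_of_index_eq_zero {G : Type*} [AddCommGroup G]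
    [AddGroup.FG G] (H : AddSubgroup G) (hH : H.index = 0) :
    ∃ K : AddSubgroup G, H ≤ K ∧ K.index = 2 := by
  haveI : AddGroup.FG (G ⧸ H) := QuotientAddGroup.fg H
  haveI : Infinite (G ⧸ H) := AddSubgroup.index_eq_zero_iff_infinite.mp hH
  obtain ⟨π, hπ⟩ := exists_addMonoidHom_int_surjective_of_infinite (Q := G ⧸ H)
  let ψ : G →+ ZMod 2 := (Int.castAddHom (ZMod 2)).comp (π.comp (QuotientAddGroup.mk' H))
  have hψ : Surjective ψ :=
    (ZMod.intCast_surjective).comp (hπ.comp (QuotientAddGroup.mk'_surjective H))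
  refine ⟨ψ.ker, fun x hx => ?_, ?_⟩
  · rw [AddMonoidHom.mem_ker]
    change Int.castAddHom (ZMod 2) (π (QuotientAddGroup.mk' H x)) = 0
    rw [QuotientAddGroup.mk'_apply, (QuotientAddGroup.eq_zero_iff x).mpr hx, map_zero, map_zero]
  · rw [AddSubgroup.index_ker, AddMonoidHom.range_eq_top.mpr hψ, AddSubgroup.card_top, Nat.card_zmod]

/-- **Multiplicative transport**: if a group `G` is isomorphic to the multiplicative version of a
finitely generated abelian group `Λ` (e.g. `π₁` of a topological group, via the Hurewicz
isomorphism onto `H₁`), then every subgroup of `G` of infinite index lies in a subgroup of index `2`.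
[folklore] -/
theorem Subgroup.exists_le_index_eq_two_of_index_eq_zero {G Λ : Type*} [Group G] [AddCommGroup Λ]
    [AddGroup.FG Λ] (e : G ≃* Multiplicative Λ) (H : Subgroup G) (hH : H.index = 0) :
    ∃ K : Subgroup G, H ≤ K ∧ K.index = 2 := by
  -- the additive image of `H` in `Λ`
  set H' : AddSubgroup Λ := AddSubgroup.toSubgroup.symm (H.map (e : G →* Multiplicative Λ)) with hH'
  have hH'i : H'.index = 0 := by
    rw [hH', ← AddSubgroup.index_toSubgroup, OrderIso.apply_symm_apply, Subgroup.index_map_equiv, hH]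
  obtain ⟨K', hle, hK'⟩ := AddSubgroup.exists_le_index_eq_two_of_index_eq_zero H' hH'i
  refine ⟨(AddSubgroup.toSubgroup K').comap (e : G →* Multiplicative Λ), fun x hx => ?_, ?_⟩
  · rw [Subgroup.mem_comap, Multiplicative.mem_toSubgroup]
    apply hle
    change Multiplicative.toAdd ((e : G →* Multiplicative Λ) x) ∈
      AddSubgroup.toSubgroup.symm (H.map (e : G →* Multiplicative Λ))
    rw [← Multiplicative.mem_toSubgroup, OrderIso.apply_symm_apply]
    exact Subgroup.mem_map_of_mem _ hx
  · rw [Subgroup.index_comap_of_surjective _ e.surjective, AddSubgroup.index_toSubgroup, hK']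

end Literature.GroupTheory.Index
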